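import Summits.QuantumFields.BalabanUV.T4Continuum.Support.NE7CoarseSplitExtension
import Summits.QuantumFields.BalabanUV.T4Continuum.Support.NE7ApeOfTorusRoadV4
import HarnessLib

/-!
# NE7CoarseSplitAssembly — THE v4 SPLIT OF THE CHART'S LINEARISED TOP AVERAGE, ASSEMBLED ((N3)″, split half): for a skew `(L^{k+1}N)`-periodic `A` with `‖A‖ ≤ α₀`
# whose flat linearised top average `ψ = D_1A` has plaquette circulations `≤ ĝ₀` within `2ℓ̃+2` blocks of a centre `c`, `D_1A = φ₁ + E` with `φ₁` `N`-periodic,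
# `sup‖curl_1 φ₁‖ ≤ (1 + 12(d+1))ĝ₀` EVERYWHERE, `E = 0` on the torus ball `{torusSupNorm(· − c) ≤ ℓ̃ − 1}` and `‖E‖ ≤ s`,
# `s = Ψ + (d+1)(4ℓ̃+2)(2Ψ + ĝ₀)`, `Ψ = (3 + 12(d+1))·L^{k+1}·α₀` (row NE3's sup letter of `D_1`) — the `φ₁ ∕ E ∕ g ∕ s` clauses of F263's bundle

Cell `pub-balaban`, rung (B)+1 sub-cell t4, lineage `b2b-balaban-t4-ne7-p1` (CRUX PROVER NE7 #1 = OWNER of row NE7), generation 89; memo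
`t4/b2b-balaban-t4-ne7-p1-g89/COSTING-N1.md` §8 (β).  File F272 (over F271b `NE7CoarseSplitExtension.exists_periodic_extension`, row NE3's `NE3LinearisedAverageSup.norm_dirIter_le_sup`
and `NE7TangentTransportGauge.dirIter_skew_periodic` at the flat background (`levelSmall_zero`, `curvSum_zero`)).

WHY (memo §8 (β)).  F263 `hape_of_torusRoadV4` hypothesises per plaquette the split `dirIter L (k+1) 1 A = φ₁ + E` with the four letters (periodic `φ₁`, global coarse
curl `≤ g`, `E` vanishing near the plaquette's block, `‖E‖ ≤ s`).  THIS FILE supplies them from ONE local input — the bound `ĝ₀` on the coarse circulations of `D_1A`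
near the centre (F259's coarse-curvature letter supplies `ĝ₀ = β′ + quadratic` at instantiation) — and the chart's sup bound `α₀`.
WHAT ([folklore] composition; 0 def, 0 sorry; dimension `d + 1`, `L ≥ 2`).  **`exists_coarse_split`** (statement below).
HONEST FRAMING (page 1): composition BY NAME; nothing of Bałaban's asserted; NOT (APE), NOT ONE-STEP, NOT NE7; spine 0∕9; finite T⁴ rung (B)+1 — NOT infinite volume,
NOT mass gap, NOT `BetaPertH`, NOT Clay.  Continuum YM on T⁴ ⇐ BetaPertH ∧ nine spine estimates (0/9 proved); BetaPertH ⇐ (D1) ∧ (D4) ∧ CAP+tail; G-an2-4 gates asym,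
D1 and NE2/3/4.
-/

set_option autoImplicit false

open scoped BigOperators Matrix.Norms.L2Operator
open NormedSpace Finset

namespace Summit.QuantumFields.BalabanUV.T4Continuum.NE7CoarseSplitAssembly

open Literature.MathematicalPhysics.QuantumFieldTheory.Balaban1983to89
open B7Prop1Explicit B7Prop2Explicit
open B4ContourShift (supNorm)
open B4TorusKernel.MultiPeriod (torusSupNorm)
open T4AveragingDeficitWall (IsUnitaryCfg IsSkewDir SmallField curlAt flat_mem_classes)
open T4AveragingDeficitWallBoundary (IsPeriodicCfg)
open AveragingDeficitPeriodicCounting (IsPeriodicDir)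
open AveragingDeficitMultiLevelPrep (LevelSmall tower)
open AveragingDeficitMultiLevelBridge (tower_eq)
open BlockAveragePushDirSplit (flat)
open NE3TangentCovariantTower (dirIter)
open NE3LinearisedAverageSup (curvSum norm_dirIter_le_sup)
open NE7TangentTransportGauge (dirIter_skew_periodic)
open NE7CoarseCurvatureLetter (levelSmall_zero curvSum_zero)
open NE7CoarseSplitExtension (exists_periodic_extension)

noncomputable section

variable {d : ℕ} {n : Type*} [Fintype n] [DecidableEq n]

/-- **THE v4 SPLIT, ASSEMBLED** (`L ≥ 2`, `ℓ̃ ≥ 1`, `N ≥ 4ℓ̃ + 8`): for `A` skew `(L^{k+1}N)`-periodic with `‖A‖ ≤ α₀` and a centre `c` such that the flat plaquette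
circulations of `ψ = dirIter L (k+1) 1 A` based within sup-distance `2ℓ̃+2` of `c` are `≤ ĝ₀`: `∃ φ₁ E`, `ψ = φ₁ + E`, `φ₁` `N`-periodic,
`‖curl_1 φ₁‖ ≤ (1 + 12(d+1))ĝ₀` everywhere, `‖E‖ ≤ s` everywhere and `E = 0` on `{torusSupNorm(· − c) ≤ ℓ̃ − 1}`, with
`s = Ψ + (d+1)(4ℓ̃+2)(2Ψ + ĝ₀)`, `Ψ = (3 + 12(d+1))·L^{k+1}·α₀`. [folklore] -/
theorem exists_coarse_split [Nonempty n] {L : ℕ} (hL : 2 ≤ L) (k : ℕ) {N ℓt : ℕ} [NeZero N] (hℓ : 1 ≤ ℓt) (hN : 4 * ℓt + 8 ≤ N)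
    {A : Site (d + 1) → Fin (d + 1) → Matrix n n ℂ} (hA : IsSkewDir A) (hAP : IsPeriodicDir A ((L ^ (k + 1) * N : ℕ) : ℤ))
    {α₀ : ℝ} (hα₀ : 0 ≤ α₀) (hAα : ∀ (y : Site (d + 1)) (μ : Fin (d + 1)), ‖A y μ‖ ≤ α₀)
    (c : Site (d + 1)) {ĝ₀ : ℝ} (hĝ₀ : 0 ≤ ĝ₀)
    (hcurl : ∀ y : Site (d + 1), supNorm (y - c) ≤ 2 * ℓt + 2 → ∀ μ ν : Fin (d + 1),
      ‖curlAt (flat (d := d + 1) (n := n)) (dirIter L (k + 1) (flat (d := d + 1) (n := n)) A) y μ ν‖ ≤ ĝ₀) :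
    ∃ φ₁ E : Site (d + 1) → Fin (d + 1) → Matrix n n ℂ,
      dirIter L (k + 1) (flat (d := d + 1) (n := n)) A = φ₁ + E ∧ IsPeriodicDir φ₁ (N : ℤ) ∧
      (∀ (y : Site (d + 1)) (μ ν : Fin (d + 1)), ‖curlAt (flat (d := d + 1) (n := n)) φ₁ y μ ν‖ ≤ (1 + 12 * ((d : ℝ) + 1)) * ĝ₀) ∧
      0 ≤ (3 + 12 * (((d + 1 : ℕ) : ℝ))) * (L : ℝ) ^ (k + 1) * α₀
            + ((d : ℝ) + 1) * (4 * ℓt + 2) * (2 * ((3 + 12 * (((d + 1 : ℕ) : ℝ))) * (L : ℝ) ^ (k + 1) * α₀) + ĝ₀) ∧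
      (∀ (y : Site (d + 1)) (lam : Fin (d + 1)), ‖E y lam‖
          ≤ (3 + 12 * (((d + 1 : ℕ) : ℝ))) * (L : ℝ) ^ (k + 1) * α₀
            + ((d : ℝ) + 1) * (4 * ℓt + 2) * (2 * ((3 + 12 * (((d + 1 : ℕ) : ℝ))) * (L : ℝ) ^ (k + 1) * α₀) + ĝ₀)) ∧
      (∀ (y : Site (d + 1)), torusSupNorm (fun _ : Fin (d + 1) => N) (y - c) ≤ (ℓt : ℝ) - 1 → ∀ lam : Fin (d + 1), E y lam = 0) := by
  classical
  have hL1 : 1 ≤ L := by omega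
  -- the flat background is in every multi-level class
  have hflatU : IsUnitaryCfg (flat (d := d + 1) (n := n)) := (flat_mem_classes (d := d + 1) (n := n) le_rfl).1
  have hflat0 : SmallField (flat (d := d + 1) (n := n)) 0 := (flat_mem_classes (d := d + 1) (n := n) le_rfl).2
  have htow : ((tower L N (k + 1) : ℕ) : ℤ) = ((L ^ (k + 1) * N : ℕ) : ℤ) := by rw [tower_eq, Nat.mul_comm]
  have hflatPt : IsPeriodicCfg (flat (d := d + 1) (n := n)) ((tower L N (k + 1) : ℕ) : ℤ) := fun _ _ _ => rfl
  have hAPt : IsPeriodicDir A ((tower L N (k + 1) : ℕ) : ℤ) := by rw [htow]; exact hAP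
  -- `ψ = D_1 A` is periodic and bounded by `Ψ`
  set ψ := dirIter L (k + 1) (flat (d := d + 1) (n := n)) A with hψ
  obtain ⟨-, hψP⟩ := dirIter_skew_periodic (M := N) hL1 k hflatU hflatPt le_rfl (levelSmall_zero L k) hflat0 hA hAPt
  have hcurv : curvSum (d + 1) L (k + 1) 0 ≤ 2 / 3 * L := by rw [curvSum_zero]; positivity
  have hΨ : ∀ (y : Site (d + 1)) (κ : Fin (d + 1)), ‖ψ y κ‖ ≤ (3 + 12 * (((d + 1 : ℕ) : ℝ))) * (L : ℝ) ^ (k + 1) * α₀ :=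
    fun y κ => norm_dirIter_le_sup (N := N) hL k hflatU hflatPt le_rfl (levelSmall_zero L k) hflat0 hA hAPt hα₀ hAα hcurv y κ
  have hΨ0 : 0 ≤ (3 + 12 * (((d + 1 : ℕ) : ℝ))) * (L : ℝ) ^ (k + 1) * α₀ := by positivity
  -- the extension (F271b)
  obtain ⟨φ₁, hφP, hφagree, hφcurl, hφsize⟩ := exists_periodic_extension (n := n) hℓ hN c ψ hψP hĝ₀ hΨ0 hcurl (fun y _ κ => hΨ y κ)
  refine ⟨φ₁, fun y κ => ψ y κ - φ₁ y κ, ?_, hφP, hφcurl, by positivity, ?_, ?_⟩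
  · funext y κ; simp
  · intro y lam
    calc ‖ψ y lam - φ₁ y lam‖ ≤ ‖ψ y lam‖ + ‖φ₁ y lam‖ := norm_sub_le _ _
      _ ≤ _ := add_le_add (hΨ y lam) (hφsize y lam)
  · intro y hy lam
    show ψ y lam - φ₁ y lam = 0
    rw [hφagree y lam hy, sub_self]

end

end Summit.QuantumFields.BalabanUV.T4Continuum.NE7CoarseSplitAssembly
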